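import Mathlib.Algebra.MvPolynomial.Funext
import Mathlib.RingTheory.MvPolynomial.Homogeneous
import HarnessLib

/-!
# Generic parameters: non-empty Zariski-open conditions on an affine parameter space, and forms of degree `d`

"For a general hypersurface `H` of degree `d` …": the parameter space of the forms
`F = ∑ c_m x^m ∈ k[x_σ]_d` is the affine space of coefficient vectors `c = (c_m)_{|m| = d}`, and
a property holds **generically** if it holds off the zeros of a non-zero polynomial `Φ(c)` in
the coefficients (i.e. on a non-empty Zariski-open subset — over an infinite field `k` such a
set has `k`-points, and finitely many such conditions hold simultaneously). This file fixes that
elementary calculus, used to combine the genericity statements of de Jong 1996, proof of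
Lemma 4.13 ("`U ⊂ 𝐏^∨` is nonempty open. Take `H' ∈ U`"):

* `IsGeneric P` for `P : (τ → k) → Prop` — `∃ Φ ≠ 0, Φ(c) ≠ 0 → P c`; closed under finite
  conjunctions over a domain (`IsGeneric.and`, `IsGeneric.forall_fintype`,
  `IsGeneric.forall_finset`), monotone, and satisfiable over an infinite domain
  (`IsGeneric.nonempty`, Mathlib `MvPolynomial.funext`);
* the coefficient parametrisation of forms: `Monomials σ d = {m : σ →₀ ℕ // |m| = d}` (finite
  for `σ` finite), `formOfCoeffs c = ∑ c_m x^m` (homogeneous of degree `d`, with `coeff` and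
  surjectivity onto `k[x]_d`, `formOfCoeffs_coeff`), and the linear polynomial
  `evalAtPoint a = ∑_m a^m T_m` in the coefficients computing `F(a)`
  (`eval_evalAtPoint : (evalAtPoint a)(c) = (formOfCoeffs c)(a)`), non-zero as soon as some
  coordinate satisfies `a i ^ d ≠ 0`, e.g. `a i = 1`, or `a i ≠ 0` over a reduced ring
  (`evalAtPoint_ne_zero`) — so "the form does not vanish at the point `a`" is a generic
  condition (`isGeneric_eval_formOfCoeffs_ne_zero`).

Over a finite coefficient ring `IsGeneric` is vacuous (see its docstring); all existence
statements assume `k` infinite.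

## References

* A. J. de Jong, *Smoothness, semi-stability and alterations*, Publ. Math. IHÉS 83 (1996),
  proof of Lemma 4.13, p. 70. [DeJong1996]
-/

universe u v

open MvPolynomial

noncomputable section

namespace Literature.AlgebraicGeometry.Resolution

/-! ### Generic conditions -/

section IsGeneric

variable {k : Type u} [CommRing k] {τ : Type v}

/-- A property `P` of parameter vectors `c : τ → k` **holds generically**: there is a non-zero
polynomial `Φ ∈ k[T_t : t ∈ τ]` such that `P c` holds whenever `Φ(c) ≠ 0` — i.e. `P` holds on
a Zariski-open subset of the affine parameter space containing the non-vanishing locus of a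
non-zero polynomial (non-empty as soon as `k` is an infinite domain, `IsGeneric.nonempty`).
Caveat: over a FINITE ring `k` this predicate is vacuous (every `P`, even `False`, is
"generic": `T² + T` vanishes identically on `𝔽₂`); it expresses existence only through
`IsGeneric.nonempty` / `IsGeneric.exists_and`, which require `k` infinite. [folklore] -/
def IsGeneric (P : (τ → k) → Prop) : Prop :=
  ∃ Φ : MvPolynomial τ k, Φ ≠ 0 ∧ ∀ c : τ → k, MvPolynomial.eval c Φ ≠ 0 → P c

namespace IsGeneric

variable {P Q : (τ → k) → Prop}

/-- A property which always holds, holds generically (over a non-trivial ring). [folklore] -/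
theorem of_forall [Nontrivial k] (h : ∀ c, P c) : IsGeneric P :=
  ⟨1, one_ne_zero, fun c _ => h c⟩

/-- Generic properties are upward closed. [folklore] -/
theorem mono (h : IsGeneric P) (hPQ : ∀ c, P c → Q c) : IsGeneric Q := by
  obtain ⟨Φ, hΦ, hP⟩ := h
  exact ⟨Φ, hΦ, fun c hc => hPQ c (hP c hc)⟩

/-- The non-vanishing of a non-zero polynomial is a generic condition. [folklore] -/
theorem eval_ne_zero {Φ : MvPolynomial τ k} (hΦ : Φ ≠ 0) :
    IsGeneric fun c : τ → k => MvPolynomial.eval c Φ ≠ 0 :=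
  ⟨Φ, hΦ, fun _ h => h⟩

/-- **Two generic conditions hold simultaneously generically** (over a domain: the product of two
non-zero polynomials is non-zero). [folklore] -/
theorem and [IsDomain k] (hP : IsGeneric P) (hQ : IsGeneric Q) : IsGeneric fun c => P c ∧ Q c := by
  obtain ⟨Φ, hΦ, hP⟩ := hP
  obtain ⟨Ψ, hΨ, hQ⟩ := hQ
  refine ⟨Φ * Ψ, mul_ne_zero hΦ hΨ, fun c hc => ?_⟩
  rw [map_mul] at hc
  exact ⟨hP c (left_ne_zero_of_mul hc), hQ c (right_ne_zero_of_mul hc)⟩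

/-- Finitely many generic conditions (indexed by a `Finset`) hold simultaneously generically.
[folklore] -/
theorem forall_finset [IsDomain k] {κ : Type*} (s : Finset κ) {R : κ → (τ → k) → Prop}
    (h : ∀ i ∈ s, IsGeneric (R i)) : IsGeneric fun c => ∀ i ∈ s, R i c := by
  classical
  induction s using Finset.induction_on with
  | empty => exact of_forall fun c i hi => absurd hi (Finset.notMem_empty i)
  | insert a s ha ih =>
    have h1 : IsGeneric (R a) := h a (Finset.mem_insert_self a s)
    have h2 : IsGeneric fun c => ∀ i ∈ s, R i c := ih fun i hi => h i (Finset.mem_insert_of_mem hi)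
    refine (h1.and h2).mono fun c hc i hi => ?_
    rcases Finset.mem_insert.mp hi with rfl | hi
    · exact hc.1
    · exact hc.2 i hi

/-- Finitely many generic conditions (indexed by a finite type) hold simultaneously generically.
[folklore] -/
theorem forall_fintype [IsDomain k] {κ : Type*} [Fintype κ] {R : κ → (τ → k) → Prop}
    (h : ∀ i, IsGeneric (R i)) : IsGeneric fun c => ∀ i, R i c :=
  (forall_finset Finset.univ fun i _ => h i).mono fun _ hc i => hc i (Finset.mem_univ i)

/-- Generic conditions indexed by a finite set of indices hold simultaneously generically.
[folklore] -/
theorem forall_mem_finite [IsDomain k] {κ : Type*} {S : Set κ} (hS : S.Finite)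
    {R : κ → (τ → k) → Prop} (h : ∀ i ∈ S, IsGeneric (R i)) :
    IsGeneric fun c => ∀ i ∈ S, R i c :=
  (forall_finset hS.toFinset fun i hi => h i (hS.mem_toFinset.mp hi)).mono fun _ hc i hi =>
    hc i (hS.mem_toFinset.mpr hi)

/-- **A generic condition is satisfiable over an infinite domain**: a non-zero polynomial over an
infinite domain has a non-zero value (Mathlib `MvPolynomial.funext`). [folklore] -/
theorem nonempty [IsDomain k] [Infinite k] (h : IsGeneric P) : ∃ c, P c := by
  obtain ⟨Φ, hΦ, hP⟩ := h
  by_contra hne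
  apply hΦ
  apply MvPolynomial.funext
  intro c
  rw [map_zero]
  by_contra hc
  exact hne ⟨c, hP c hc⟩

/-- Over an infinite domain a generic condition holds together with any further generic condition
at some parameter: the typical use, "choose `c` generic with `P c`, avoiding finitely many bad
loci". [folklore] -/
theorem exists_and [IsDomain k] [Infinite k] (hP : IsGeneric P) (hQ : IsGeneric Q) :
    ∃ c, P c ∧ Q c :=
  (hP.and hQ).nonempty

end IsGeneric

end IsGeneric

/-! ### Forms of degree `d` parametrised by their coefficients -/

section Forms

variable (σ : Type v) (d : ℕ)

/-- The exponents of the monomials of degree `d` in the variables `σ`. [folklore] -/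
abbrev Monomials : Type v := {m : σ →₀ ℕ // m.degree = d}

/-- There are finitely many monomials of degree `d` in finitely many variables (Mathlib
`Finsupp.finite_of_degree_eq`). Note: `Monomials` being an `abbrev`, this registers a global
instance on the bare subtype `{m : σ →₀ ℕ // m.degree = d}` (the local instance built in
`Motives/ProjectiveSpaceSections.lean` is then redundant but compatible, `Fintype` being a
subsingleton). [folklore] -/
instance Monomials.finite [Finite σ] : Finite (Monomials σ d) :=
  (Finsupp.finite_of_degree_eq (σ := σ) d).to_subtype

/-- A (non-computable) enumeration of the monomials of degree `d`. [folklore] -/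
instance Monomials.fintype [Finite σ] : Fintype (Monomials σ d) := Fintype.ofFinite _

variable {σ d} {k : Type u} [CommRing k]

/-- **The form with coefficient vector `c`**: `F_c = ∑_{|m| = d} c_m x^m`. [folklore] -/
def formOfCoeffs [Finite σ] (c : Monomials σ d → k) : MvPolynomial σ k :=
  ∑ m : Monomials σ d, MvPolynomial.monomial m.1 (c m)

/-- `F_c` is homogeneous of degree `d`. [folklore] -/
theorem isHomogeneous_formOfCoeffs [Finite σ] (c : Monomials σ d → k) :
    (formOfCoeffs c).IsHomogeneous d := by
  unfold formOfCoeffs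
  refine MvPolynomial.IsHomogeneous.sum _ _ _ fun m _ => ?_
  exact MvPolynomial.isHomogeneous_monomial _ m.2

/-- The coefficients of `F_c` at monomials of degree `d` are the `c_m`. [folklore] -/
@[simp]
theorem coeff_formOfCoeffs [Finite σ] (c : Monomials σ d → k) (m : Monomials σ d) :
    MvPolynomial.coeff m.1 (formOfCoeffs c) = c m := by
  classical
  unfold formOfCoeffs
  rw [MvPolynomial.coeff_sum, Finset.sum_eq_single m]
  · rw [MvPolynomial.coeff_monomial, if_pos rfl]
  · intro m' _ hm'
    rw [MvPolynomial.coeff_monomial, if_neg]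
    exact fun h => hm' (Subtype.ext h)
  · exact fun h => absurd (Finset.mem_univ m) h

/-- The coefficients of `F_c` at monomials of other degrees vanish. [folklore] -/
theorem coeff_formOfCoeffs_of_degree_ne [Finite σ] (c : Monomials σ d → k) {n : σ →₀ ℕ}
    (hn : n.degree ≠ d) : MvPolynomial.coeff n (formOfCoeffs c) = 0 := by
  classical
  unfold formOfCoeffs
  rw [MvPolynomial.coeff_sum]
  refine Finset.sum_eq_zero fun m _ => ?_
  rw [MvPolynomial.coeff_monomial, if_neg]
  exact fun h => hn (h ▸ m.2)

/-- **Every form of degree `d` is an `F_c`** (surjectivity of the coefficient parametrisation).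
[folklore] -/
theorem formOfCoeffs_coeff [Finite σ] {F : MvPolynomial σ k} (hF : F.IsHomogeneous d) :
    formOfCoeffs (fun m : Monomials σ d => MvPolynomial.coeff m.1 F) = F := by
  classical
  apply MvPolynomial.ext
  intro n
  by_cases hn : n.degree = d
  · exact coeff_formOfCoeffs _ ⟨n, hn⟩
  · rw [coeff_formOfCoeffs_of_degree_ne _ hn]
    symm
    by_contra h
    exact hn (by rw [Finsupp.degree_eq_weight_one]; exact hF h)

/-- A property of forms of degree `d` holds for all forms iff it holds for all `F_c`. [folklore] -/
theorem forall_isHomogeneous_iff [Finite σ] {R : MvPolynomial σ k → Prop} :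
    (∀ F : MvPolynomial σ k, F.IsHomogeneous d → R F) ↔
      ∀ c : Monomials σ d → k, R (formOfCoeffs c) :=
  ⟨fun h c => h _ (isHomogeneous_formOfCoeffs c), fun h _ hF => formOfCoeffs_coeff hF ▸ h _⟩

/-- **`F(a)` as a polynomial in the coefficients of `F`**: the linear polynomial
`∑_{|m| = d} a^m T_m ∈ k[T_m : |m| = d]`. [folklore] -/
def evalAtPoint [Finite σ] (a : σ → k) : MvPolynomial (Monomials σ d) k :=
  ∑ m : Monomials σ d, MvPolynomial.C (m.1.prod fun j e => a j ^ e) * MvPolynomial.X m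

/-- `evalAtPoint a` evaluated at the coefficient vector `c` is `F_c(a)`. [folklore] -/
theorem eval_evalAtPoint [Finite σ] (a : σ → k) (c : Monomials σ d → k) :
    MvPolynomial.eval c (evalAtPoint a) = MvPolynomial.eval a (formOfCoeffs c) := by
  unfold evalAtPoint formOfCoeffs
  simp only [map_sum, map_mul, MvPolynomial.eval_C, MvPolynomial.eval_X,
    MvPolynomial.eval_monomial]
  exact Finset.sum_congr rfl fun m _ => mul_comm _ _

/-- The coefficient of `T_m` in `evalAtPoint a` is `a^m`. [folklore] -/
theorem coeff_evalAtPoint [Finite σ] (a : σ → k) (m : Monomials σ d) :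
    MvPolynomial.coeff (Finsupp.single m 1) (evalAtPoint a) = m.1.prod fun j e => a j ^ e := by
  classical
  unfold evalAtPoint
  rw [MvPolynomial.coeff_sum, Finset.sum_eq_single m]
  · rw [MvPolynomial.coeff_C_mul, MvPolynomial.coeff_X, if_pos rfl, mul_one]
  · intro m' _ hm'
    rw [MvPolynomial.coeff_C_mul, MvPolynomial.coeff_X, if_neg, mul_zero]
    exact fun h => hm' (Finsupp.single_left_injective one_ne_zero h)
  · exact fun h => absurd (Finset.mem_univ m) h

/-- **`evalAtPoint a ≠ 0` as soon as some coordinate `a i` is not nilpotent of order `≤ d`**, in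
particular over a reduced ring as soon as some `a i ≠ 0`, or whenever some `a i = 1`: the
coefficient of `T_{x_i^d}` is `a_i^d`. [folklore] -/
theorem evalAtPoint_ne_zero [Finite σ] {a : σ → k} {i : σ} (ha : a i ^ d ≠ 0) :
    evalAtPoint (d := d) a ≠ 0 := by
  intro h
  have hm : (Finsupp.single i d : σ →₀ ℕ).degree = d := by
    rw [Finsupp.degree_single]
  have := coeff_evalAtPoint (d := d) a ⟨Finsupp.single i d, hm⟩
  rw [h, MvPolynomial.coeff_zero] at this
  apply ha
  rw [this]
  simp

/-- **"The form does not vanish at the point `a`" is a generic condition on the form**, for any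
`a` with a coordinate `a i` such that `a i ^ d ≠ 0` (e.g. `a i = 1`). [folklore] -/
theorem isGeneric_eval_formOfCoeffs_ne_zero [Finite σ] {a : σ → k} {i : σ} (ha : a i ^ d ≠ 0) :
    IsGeneric fun c : Monomials σ d → k => MvPolynomial.eval a (formOfCoeffs c) ≠ 0 := by
  refine ⟨evalAtPoint a, evalAtPoint_ne_zero ha, fun c hc => ?_⟩
  rwa [eval_evalAtPoint] at hc

end Forms

end Literature.AlgebraicGeometry.Resolution

end
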